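import Summits.ValiantsHypothesis.ValiantsHypothesis.Theses.SliceSignRank
import Summits.ValiantsHypothesis.ValiantsHypothesis.Theorems.SliceSignRankPositiveSliceNormalFormSplit

/-!
# Route SliceSignRank — crux `SrkNotQP` (stmt-ValiantsHypothesis-20857), line `forster_slice`:
# the crux from the factorial-power lower bound, without determinants or permanents

`SliceSignRankSrkNotQPForsterSliceEquiv[Polya]` shows that the registered stub `stub_forsterSlice` is
EQUIVALENT to the factorial-power lower bound

  `FPL : ∃ C, ∀ n ≥ 3, ∀ k W, (k-term real sign-representation of sgn on S_n) → n! ≤ k^C`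

(`srk(n) ≥ (n!)^{1/C}`). This file records the direct bridge from that clean statement to the route
decls, so that a proof of `FPL` closes the crux with no detour through Forster twists:

* `qp_pow_lt_factorial` — quasi-polynomial versus factorial: for every `c, C` eventually
  `k ≤ 2^{(log₂ n + c)^c} ⇒ k^C < n!` (`(L+c)^c·C ≤ 2^L ≤ n` and `2ⁿ < n!`);
* `signRankSuperQP_of_factorialPowerLower : FPL → SignRankSuperQP` (a.e. form, sibling crux
  stmt-15118) and `srkNotQP_of_factorialPowerLower : FPL → SrkNotQP` (this crux, via the landed
  `srkNotQP_of_signRankSuperQP`).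

HONEST CALIBRATION: `FPL` is conjecture-grade (it is the stub); nothing here proves it. Both cruxes
remain OPEN; `VP ≠ VNP` is untouched. `poly_le_two_pow_eventually` is the line skeleton's lemma
(planner, `Cruxes/SrkNotQP/Lines/forster_slice.lean`), copied so that Theorems do not import Cruxes.
-/

-- Sub = Summit layout duplicates the namespace component
set_option linter.dupNamespace false

namespace Summit.ValiantsHypothesis.ValiantsHypothesis.Theorems.SliceSignRank.SrkNotQP

open Finset

/-! ## §1 Quasi-polynomial versus factorial -/

/-- Polynomial versus exponential: `(L + c)^c · C ≤ 2^L` for all large `L`.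
[folklore; verbatim the line skeleton's `poly_le_two_pow_eventually`] -/
theorem poly_le_two_pow_eventually' (c C : ℕ) :
    ∃ L₀ : ℕ, ∀ L : ℕ, L₀ ≤ L → (L + c) ^ c * C ≤ 2 ^ L := by
  have ht := tendsto_pow_const_div_const_pow_of_one_lt c (one_lt_two : (1 : ℝ) < 2)
  set ε : ℝ := ((2 : ℝ) ^ c * ((C : ℝ) + 1))⁻¹ with hε_def
  have hD : (0 : ℝ) < (2 : ℝ) ^ c * ((C : ℝ) + 1) := by positivity
  have hε : (0 : ℝ) < ε := inv_pos.mpr hD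
  obtain ⟨L₁, hL₁⟩ := Filter.eventually_atTop.mp (ht.eventually_lt_const hε)
  refine ⟨max L₁ c, fun L hL => ?_⟩
  have hL1 : L₁ ≤ L := le_of_max_le_left hL
  have hLc : c ≤ L := le_of_max_le_right hL
  have h2L : (0 : ℝ) < (2 : ℝ) ^ L := by positivity
  have h : (L : ℝ) ^ c / 2 ^ L < ε := hL₁ L hL1
  rw [div_lt_iff₀ h2L] at h
  have h' : (L : ℝ) ^ c * ((2 : ℝ) ^ c * ((C : ℝ) + 1)) < (2 : ℝ) ^ L := by
    have := mul_lt_mul_of_pos_right h hD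
    calc (L : ℝ) ^ c * ((2 : ℝ) ^ c * ((C : ℝ) + 1))
        < ε * 2 ^ L * ((2 : ℝ) ^ c * ((C : ℝ) + 1)) := this
      _ = (ε * ((2 : ℝ) ^ c * ((C : ℝ) + 1))) * 2 ^ L := by ring
      _ = 2 ^ L := by rw [hε_def, inv_mul_cancel₀ hD.ne', one_mul]
  have hnat : (((L + c) ^ c * C : ℕ) : ℝ) < ((2 ^ L : ℕ) : ℝ) := by
    push_cast
    have hLc' : (c : ℝ) ≤ L := by exact_mod_cast hLc
    calc ((L : ℝ) + c) ^ c * C ≤ ((L : ℝ) + L) ^ c * C := by gcongr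
      _ = (L : ℝ) ^ c * ((2 : ℝ) ^ c * (C : ℝ)) := by ring
      _ ≤ (L : ℝ) ^ c * ((2 : ℝ) ^ c * ((C : ℝ) + 1)) := by gcongr; linarith
      _ < (2 : ℝ) ^ L := h'
  exact (by exact_mod_cast hnat : (L + c) ^ c * C < 2 ^ L).le

/-- `2ⁿ < n!` for `n ≥ 4`. [folklore] -/
theorem two_pow_lt_factorial (n : ℕ) (hn : 4 ≤ n) : 2 ^ n < n.factorial := by
  induction n, hn using Nat.le_induction with
  | base => decide
  | succ m hm ih =>
    rw [Nat.factorial_succ, pow_succ]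
    calc 2 ^ m * 2 < m.factorial * 2 := Nat.mul_lt_mul_of_pos_right ih two_pos
      _ ≤ m.factorial * (m + 1) := Nat.mul_le_mul_left _ (by omega)
      _ = (m + 1) * m.factorial := Nat.mul_comm _ _

/-- **Quasi-polynomial versus factorial**: for every `c, C` there is `n₀ ≥ 4` such that
`k ≤ 2^{(log₂ n + c)^c}` implies `k^C < n!` for all `n ≥ n₀` (`k^C ≤ 2^{C (L+c)^c} ≤ 2^{2^L} ≤ 2ⁿ < n!`
with `L = log₂ n`). [folklore] -/
theorem qp_pow_lt_factorial (c C : ℕ) :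
    ∃ n₀ : ℕ, 4 ≤ n₀ ∧ ∀ n : ℕ, n₀ ≤ n → ∀ k : ℕ, k ≤ 2 ^ ((Nat.log 2 n + c) ^ c) →
      k ^ C < n.factorial := by
  obtain ⟨L₀, hL₀⟩ := poly_le_two_pow_eventually' c C
  refine ⟨2 ^ max L₀ 2, ?_, fun n hn k hk => ?_⟩
  · calc 4 = 2 ^ 2 := by norm_num
      _ ≤ 2 ^ max L₀ 2 := Nat.pow_le_pow_right two_pos (le_max_right _ _)
  have hn0 : n ≠ 0 := by
    have : 0 < 2 ^ max L₀ 2 := pow_pos two_pos _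
    omega
  set L := Nat.log 2 n with hL
  have hLge : max L₀ 2 ≤ L := Nat.le_log_of_pow_le one_lt_two hn
  have h2L : 2 ^ L ≤ n := Nat.pow_log_le_self 2 hn0
  have hA : (L + c) ^ c * C ≤ 2 ^ L := hL₀ L (le_of_max_le_left hLge)
  have h4 : 4 ≤ n := le_trans (by
    calc 4 = 2 ^ 2 := by norm_num
      _ ≤ 2 ^ max L₀ 2 := Nat.pow_le_pow_right two_pos (le_max_right _ _)) hn
  calc k ^ C ≤ (2 ^ ((L + c) ^ c)) ^ C := Nat.pow_le_pow_left hk C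
    _ = 2 ^ ((L + c) ^ c * C) := (pow_mul 2 _ _).symm
    _ ≤ 2 ^ (2 ^ L) := Nat.pow_le_pow_right two_pos hA
    _ ≤ 2 ^ n := Nat.pow_le_pow_right two_pos h2L
    _ < n.factorial := two_pow_lt_factorial n h4

/-! ## §2 The cruxes from the factorial-power lower bound -/

/-- **`srk(n) ≥ (n!)^{1/C}` implies the sibling crux `SignRankSuperQP`** (a.e. super-quasi-polynomial
sign-rank hardness of `sgn`): for `n ≥ max(n₀, 3)` and `k ≤ 2^{(log₂ n + c)^c}` a representation
would give `n! ≤ k^C < n!`. The hypothesis is the factorial-power form of `stub_forsterSlice`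
(equivalent to it by `forsterSlice_iff_factorialPowerLower'`); it is OPEN. [this file] -/
theorem signRankSuperQP_of_factorialPowerLower
    (hL : ∃ C : ℕ, ∀ (n k : ℕ) (W : Fin k → Matrix (Fin n) (Fin n) ℝ), 3 ≤ n →
      (∀ σ : Equiv.Perm (Fin n), 0 < ((Equiv.Perm.sign σ : ℤ) : ℝ) * ∑ t, ∏ i, W t (σ i) i) →
      n.factorial ≤ k ^ C) :
    Theses.SliceSignRank.SignRankSuperQP := by
  unfold Theses.SliceSignRank.SignRankSuperQP
  obtain ⟨C, hC⟩ := hL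
  intro c
  obtain ⟨n₀, hn₀4, hn₀⟩ := qp_pow_lt_factorial c C
  refine ⟨max n₀ 3, fun n hn k hk hrep => ?_⟩
  obtain ⟨W, hW⟩ := hrep
  have h1 : n.factorial ≤ k ^ C := hC n k W (le_of_max_le_right hn) hW
  have h2 : k ^ C < n.factorial := hn₀ n (le_of_max_le_left hn) k hk
  omega

/-- **`srk(n) ≥ (n!)^{1/C}` implies the crux `SrkNotQP`** (stmt-ValiantsHypothesis-20857), through
the sibling `SignRankSuperQP` and the landed `srkNotQP_of_signRankSuperQP`. Conditional on the OPEN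
factorial-power bound (⟺ `stub_forsterSlice`). [this file] -/
theorem srkNotQP_of_factorialPowerLower
    (hL : ∃ C : ℕ, ∀ (n k : ℕ) (W : Fin k → Matrix (Fin n) (Fin n) ℝ), 3 ≤ n →
      (∀ σ : Equiv.Perm (Fin n), 0 < ((Equiv.Perm.sign σ : ℤ) : ℝ) * ∑ t, ∏ i, W t (σ i) i) →
      n.factorial ≤ k ^ C) :
    Theses.SliceSignRank.SrkNotQP :=
  SliceSignRankPositiveSliceNormalFormSplit.srkNotQP_of_signRankSuperQP
    (signRankSuperQP_of_factorialPowerLower hL)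

end Summit.ValiantsHypothesis.ValiantsHypothesis.Theorems.SliceSignRank.SrkNotQP
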